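import Summits.PneNP.PneNP.Theses.SzkEntropy
import Summits.PneNP.PneNP.Theorems.SzkEntropyPeaWorstToAvg
import Summits.PneNP.PneNP.Theorems.SzkEntropyPeaWorstToAvgAdviceLeak
import Summits.PneNP.PneNP.Theorems.SzkEntropyPeaWorstToAvgReductions
import Summits.PneNP.PneNP.Theorems.SzkEntropyPeaThreeNotInPKillSwitch
import Summits.PneNP.PneNP.Theorems.PeaWorstToAvg.Negative.NotPeaWorstToAvgImpliesTarget
import Summits.PneNP.PneNP.Theorems.PeaWorstToAvg.Negative.PeaWorstToAvgStrengthenings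
import Literature.Computability.Complexity.RandomizedProofs
import Literature.Computability.Complexity.PolynomialEntropyApproximation
import Literature.Computability.Complexity.PromiseZPPProofs
import Literature.Computability.MetaComplexity.SamplableMixtures
import Summits.PneNP.PneNP.Theorems.PeaWorstToAvg.Negative.PeaWorstToAvgAdviceAsymmetry
import Summits.PneNP.PneNP.Theorems.PeaWorstToAvg.Negative.PeaWorstToAvgWeakForm
import Summits.PneNP.PneNP.Theorems.PeaWorstToAvg.Negative.PeaWorstToAvgNonVacuity
import Summits.PneNP.PneNP.Theorems.PeaWorstToAvg.Negative.PeaWorstToAvgModeKitObstructions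
import Summits.PneNP.PneNP.Theorems.PeaWorstToAvg.Negative.AdviceElimLoadBearing
import Literature.Computability.Complexity.PolyTimeCountable
import Literature.Computability.Complexity.RandomizedProofs
import Literature.Computability.Complexity.RandomizingPolynomialsGenericBlock
import Mathlib.MeasureTheory.Measure.MeasureSpace

/-!
# Disproof of `PeaWorstToAvg` (crux stmt-PneNP-10777, route PneNP/SzkEntropy) — standing adversary file

Crux #3 (rank 3, "hardest / most informative", filed OPEN):

  `PeaWorstToAvg : PEA 3 ∉ PromiseBPP' → ∃ D : Ensemble, D.IsPolySamplable ∧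
      (∀ n, ∀ w ∈ supp Dₙ, w ∈ (PEA 3).yes ∨ w ∈ (PEA 3).no) ∧ ((PEA 3).yes, D) ∉ HeurBPP`

— worst-case hardness of cubic entropy approximation for randomized polynomial time should give a
polynomial-time samplable ensemble of promise instances on which every randomized heuristic scheme
fails (Dvir–Gutfreund–Rothblum–Vadhan's open programme "average-case hardness from the worst-case
hardness of `SZKP_L`", ICS 2011 pp. 2–3).

Authors: refuter-cdisprove-stmt-PneNP-10777-g2-0 (generation 2, §§1–7) and
refuter-cdisprove-stmt-PneNP-10777-g3-0 (generation 3, 2026-08-16: §8 TARGETS for the picked line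
`dual-mode-compile`, skeleton fd0625e15dd7 — read §8 first if you hold a stub of that line).  The generation-1
file (refuter-cdisprove-stmt-PneNP-10777-0, cycle 1, attached as item evidence 2026-08-15T22:41Z, before
crux workfiles existed) is not readable from the compute-free hub; its two conclusive sections were
meanwhile LANDED by provers and are IMPORTED: `Theorems/SzkEntropyPeaWorstToAvg.lean` (the converse
direction `szkEntropy_peaWorstToAvg_converse`, `mem_HeurBPP_of_mem_PromiseBPP'`) and
`Theorems/SzkEntropyPeaWorstToAvgAdviceLeak.lean` (sampler-side advice leak, `not_countable_PSamp`).
VERDICT SO FAR: NO KILL, and none is possible short of `P ≠ NP` (§2); the conclusive cycle-2 content is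
LANDED under `Theorems/PeaWorstToAvg/Negative/` (p72630, p72678 — imported above — and p73988
`PeaWorstToAvgAdviceAsymmetry.lean`, not yet built on the farm at publication time, hence CITED by name and not
imported; p74685 `PeaWorstToAvgWeakForm.lean` = §5b pending) and mostly ALIASED here.  Everything is `lean check` rc 0, no `sorry`,
axioms ⊆ {propext, Classical.choice, Quot.sound}, unless marked REMARK.

## Findings — index

§1 THE DISPROOF OBLIGATION [LANDED p72630, `szkEntropy_not_peaWorstToAvg_iff`]. `¬ PeaWorstToAvg` is
   EXACTLY "`PEA 3 ∉ PromiseBPP'` AND every samplable on-promise ensemble is `HeurBPP`-easy" — an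
   `SZK`-Heuristica for `PEA₃` (`PeaHeuristica` below), [Impagliazzo1995, §2.2 p. 5].
§2 WHY IT RESISTS [LANDED p72630]. A disproof proves the route's THESIS X (`¬crux → PeaThreeNotInP`,
   via the proved `PromiseP ⊆ PromiseBPP'`), refutes the kill switch, and with the ONE printed support
   `PeaMemPH` proves the SUMMIT (`szkEntropy_not_peaWorstToAvg_imp_pneNP_of_peaMemPH`, through the
   certified `closes` and the proved `szkEntropy_phCollapse_proof`, `cookModelBridge_proof`).  No
   `_false_without_` theorem exists short of `P ≠ NP`; only a MIS-STATEMENT could be refutable (§3–§5).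
§3 HYPOTHESIS MUTATION [LANDED p72630]. (a) dropping the hypothesis leaves a statement implying X and the
   crux (`szkEntropy_peaWorstToAvg_withoutHyp_imp`); (b) weakening it to `PEA 3 ∉ PromiseP` yields EXACTLY
   `crux ∧ (PEA 3 ∈ PromiseBPP' → PEA 3 ∈ PromiseP)` (`szkEntropy_peaWorstToAvg_detHyp_iff`), the surplus
   discharged under a `2^{εn}`-hard `E`-language (`…_of_avgHard_E`): the `BPP'` antecedent is right.
§4 STRENGTHENINGS / TRIVIAL CASES [LANDED p72678]. The ∀-version is FALSE (`szkEntropy_peaWorstToAvg_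
   not_forall`: point mass on the empty no-instance — samplable, on-promise, easy); one-sided ensembles
   are easy, a hard `D` charges both sides (`pea_exists_yes_and_no_of_not_mem_HeurBPP`): the ∃D must be
   PLANTED and two-sided; re-randomising one map in its entropy class (orbit files) never yields it.
   (iii) NEW HERE: the side conditions are jointly satisfiable by a two-sided samplable ensemble
   (`exists_twoSided_samplable_onPromise`; identity-map yes-instance `encode_idInst_mem_yes`) — non-vacuity.
§5 THE ADVICE ASYMMETRY [LANDED p73988]. (a) Scheme side of the `coinLen` leak: for EVERY `a : ℕ → Bool`
   and EVERY ensemble, `({x | a (size |x|)}, D) ∈ HeurBPP` (`mem_HeurBPP_sizeClass`; the scheme reads a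
   bit of its own coin COUNT), so `{L | (L, U) ∈ HeurBPP}` is uncountable
   (`not_countable_heurBPP_uniformEnsemble`) — the tree's `HeurBPP` is `HeurBPP/log`; with
   `not_countable_PSamp` BOTH quantifiers of the conclusion are advice-laden while the hypothesis is
   uniform.  (b) If SOME tree scheme decides `PEA₃` on the promise, the crux collapses to
   `PEA 3 ∈ PromiseBPP'` (`szkEntropy_peaWorstToAvg_iff_mem_of_promiseScheme`).  (c) NEW HERE (§5b,
   `weak_iff`): the QUANTIFIER-SWAPPED crux `∀ scheme ∃ D` — trivially TRUE in the intended uniform model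
   (point masses are samplable) — is in the tree's model EQUIVALENT to pure advice elimination
   "`PEA 3 ∉ PromiseBPP'` → no `coinLen`-advice scheme decides `PEA₃` on the promise at `m ≥ 2`", with
   NO average-case content left.  So the typed crux = (intended DGRV statement, uniform) ⊕ (an
   advice-elimination statement for `PEA₃`).  REPAIR NOTE for the planner (not a refutation: the
   separating world "`PEA₃ ∈ prBPP/log ∖ prBPP'`" is not provable): pin `RandAlg.coinLen` to a polynomial
   in `Randomized.lean`, or accept that a proof must defeat `O(log)`-advice schemes.
§6 PRINTED LANDMARKS (REMARK, page-cited, see the docstring of `printedLandmarks`).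
§7 REGIMES TRIED for the ∃D (REMARK + kit job j009530, see `regimesTried`).
§9 (gen 3) REMARKS for the SECOND picked line `orbit-pair-rsr` (lead b): how §8 applies to `stub_transfer`
   (per (length, chosen size) slice, ε = 19/48), the dyadic-atoms caveat for orbit samplers, shared adviceElim.
§8 TARGETS (gen 3) — line `dual-mode-compile` PICKED; per-stub verdicts in the §8 docblock below.  NEW THEOREMS:
   `ModeKitOver.exactInvariant_const` / `.not_entropyExact` (NO entropy-exact or invariant-exact encoder can be a
   mode kit: explicit same-length yes-instances of entropies 2 ≠ 1), `.enc_separates` (enc's yes/no laws are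
   ≥ 7/8 apart in TV), `.det_collapse` / `.det_heavyAtom` (coin-free encoders are constant per length ⇒
   `PEA₃ ∈ prBPP'`), `Obstruction.card_mul_le_of_dominated_classes` (old §6 invariant counting, re-proved, in
   domination form), `blockOf_eq_gBlock` (`stub_blockPerf` = tree `perfExt_gBlock` up to `corner = det`), and
   `AdviceElim.adviceElim_false_without_labels` (`stub_adviceElim` minus its certificates is FALSE: `UHeurBPP ⊊
   HeurBPP` on `δ_{1ⁿ}`, via countability of uniform schemes) and `…_without_samplability` (the samplers are
   load-bearing too), `CornerDet.corner_eq_det` (positive helper closing the gap of `stub_canon`/`blockPerf`).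
   LANDED & IMPORTED: p77449 `Negative/AdviceElimLoadBearing.lean`, p77376
   `Negative/PeaWorstToAvgModeKitObstructions.lean` (§8.2/§8.5 are now aliases); pending: p78400 (robust
   forms, kept here as `_robust`), `corner_eq_det` as `Literature/…/RandomizingPolynomialsCornerDet.lean`
   (the other CornerDet facts landed meanwhile in drefute's `RandomizingPolynomialsHessenberg.lean`, p78376).
-/

namespace Summit.PneNP.PneNP.Cruxes.PeaWorstToAvg.Disproof

open Literature.Computability.Complexity Literature.Computability.MetaComplexity
open Summit.PneNP.PneNP.Theses.SzkEntropy Summit.PneNP.PneNP.Theorems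
open _root_.Computability

/-! ## §1–§2 The disproof obligation; why it resists (aliases of landed theorems) -/

/-- **`SZK`-Heuristica for `PEA₃`**: worst-case hard for randomized polynomial time, yet every
samplable on-promise ensemble is `HeurBPP`-easy. [Impagliazzo1995, §2.2 p. 5;
DvirGutfreundRothblumVadhan2010, pp. 2–3] -/
def PeaHeuristica : Prop :=
  PEA 3 ∉ PromiseBPP' ∧ ∀ D : Ensemble, D.IsPolySamplable →
    (∀ n : ℕ, ∀ w ∈ (D n).support, w ∈ (PEA 3).yes ∨ w ∈ (PEA 3).no) →
      (⟨(PEA 3).yes, D⟩ : DistProblem) ∈ HeurBPP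

/-- `¬ PeaWorstToAvg ↔ PeaHeuristica` (landed: `szkEntropy_not_peaWorstToAvg_iff`).
[Impagliazzo1995, §2.2; BogdanovTrevisan2006, Def. 2.12–2.13] -/
theorem not_peaWorstToAvg_iff : ¬ PeaWorstToAvg ↔ PeaHeuristica :=
  szkEntropy_not_peaWorstToAvg_iff

/-- A disproof proves thesis X (landed). [DvirGutfreundRothblumVadhan2010, Thm 1.1] -/
theorem not_peaWorstToAvg_imp_peaThreeNotInP (h : ¬ PeaWorstToAvg) : PeaThreeNotInP :=
  szkEntropy_not_peaWorstToAvg_imp_peaThreeNotInP h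

/-- A disproof plus `PeaMemPH` proves the summit (landed). [DvirGutfreundRothblumVadhan2010, Thm 1.1;
AroraBarakCC2009, Thm 5.4] -/
theorem not_peaWorstToAvg_imp_pneNP_of_peaMemPH (h : ¬ PeaWorstToAvg) (hPH : PeaMemPH) :
    _root_.PneNP :=
  szkEntropy_not_peaWorstToAvg_imp_pneNP_of_peaMemPH h hPH

/-! ## §3–§4 Hypothesis mutation, strengthenings (aliases) -/

/-- The `P`-hypothesis version is the crux plus promise-derandomisation (landed). [Goldreich2006, Def. 1.2] -/
theorem detHyp_iff :
    (PEA 3 ∉ PromiseP → ∃ D : Ensemble, D.IsPolySamplable ∧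
        (∀ n : ℕ, ∀ w ∈ (D n).support, w ∈ (PEA 3).yes ∨ w ∈ (PEA 3).no) ∧
        (⟨(PEA 3).yes, D⟩ : DistProblem) ∉ HeurBPP) ↔
      PeaWorstToAvg ∧ (PEA 3 ∈ PromiseBPP' → PEA 3 ∈ PromiseP) :=
  szkEntropy_peaWorstToAvg_detHyp_iff

/-- The ∀-strengthening is false (landed). [BogdanovTrevisan2006, §2.3] -/
theorem not_forall_ensembles :
    ¬ ∀ D : Ensemble, D.IsPolySamplable →
        (∀ n : ℕ, ∀ w ∈ (D n).support, w ∈ (PEA 3).yes ∨ w ∈ (PEA 3).no) →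
        (⟨(PEA 3).yes, D⟩ : DistProblem) ∉ HeurBPP :=
  szkEntropy_peaWorstToAvg_not_forall

/-! ### §4(iii) Non-vacuity of the ∃D's side conditions: two-sided samplable on-promise ensembles exist -/

/-- The identity map on `F₂¹` with threshold `k = 0`: a YES instance of every `PEA d`, `d ≥ 1`
(`H = 1 ≥ 0 + 1`; entropy of an injective map is `log₂` of the domain size). [DvirGutfreundRothblumVadhan2010,
§3 p. 6; Claim 2.2] -/
theorem encode_idInst_mem_yes {d : ℕ} (hd : 1 ≤ d) :
    PEAInst.encoding.encode (⟨1, ([[[0]]], 0)⟩ : PEAInst) ∈ (PEA d).yes := by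
  refine (encode_mem_PEA_yes_iff d _).2 ⟨?_, ?_⟩
  · intro p hp μ hμ
    simp only [List.mem_singleton] at hp
    subst hp
    simp only [List.mem_singleton] at hμ
    subst hμ
    simpa using hd
  · show ((0 : ℕ) : ℝ) + 1 ≤ PolyMapF2.entropy ([[[0]]] : PolyMapF2 1)
    have hinj : Function.Injective (PolyMapF2.eval ([[[0]]] : PolyMapF2 1)) := by
      intro x y hxy
      have h0 : x 0 = y 0 := by simpa [PolyMapF2.eval] using hxy
      funext i
      have hi : i = 0 := Subsingleton.elim i 0
      rw [hi, h0]
    rw [PolyMapF2.entropy, mapEntropy_of_injective _ hinj, Finset.card_univ, Fintype.card_fun,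
      ZMod.card, Fintype.card_fin]
    norm_num

/-- **A two-sided, polynomial-time samplable, on-promise ensemble exists** (fair mixture of the point
masses on the identity yes-instance and the empty no-instance; `isPolySamplable_mixEnsemble`,
`isPolySamplable_const`): the side conditions of the crux's ∃D are jointly satisfiable by a two-sided
family — non-vacuity of the interface (the witness is of course `HeurBPP`-easy: compare with a constant).
[BogdanovTrevisan2006, Def. 2.1] -/
theorem exists_twoSided_samplable_onPromise :
    ∃ D : Ensemble, D.IsPolySamplable ∧
      (∀ n : ℕ, ∀ w ∈ (D n).support, w ∈ (PEA 3).yes ∨ w ∈ (PEA 3).no) ∧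
      (∀ n, ∃ w ∈ (D n).support, w ∈ (PEA 3).yes) ∧ (∀ n, ∃ w ∈ (D n).support, w ∈ (PEA 3).no) := by
  set yW := PEAInst.encoding.encode (⟨1, ([[[0]]], 0)⟩ : PEAInst) with hyW
  set nW := PEAInst.encoding.encode (⟨0, ([], 0)⟩ : PEAInst) with hnW
  have hy : yW ∈ (PEA 3).yes := encode_idInst_mem_yes (by norm_num)
  have hn : nW ∈ (PEA 3).no := encode_peaEmptyInst_mem_no 3
  refine ⟨mixEnsemble (fun _ => PMF.pure yW) (fun _ => PMF.pure nW),
    Ensemble.isPolySamplable_mixEnsemble (isPolySamplable_const yW) (isPolySamplable_const nW),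
    fun n w hw => ?_, fun n => ⟨yW, ?_, hy⟩, fun n => ⟨nW, ?_, hn⟩⟩
  · rw [mem_support_mixEnsemble_iff] at hw
    rcases hw with hw | hw
    · left
      have : w = yW := by simpa using hw
      rw [this]
      exact hy
    · right
      have : w = nW := by simpa using hw
      rw [this]
      exact hn
  · rw [mem_support_mixEnsemble_iff]
    left
    simp
  · rw [mem_support_mixEnsemble_iff]
    right
    simp

/-! ## §5 The advice asymmetry -/

/-- **A promise scheme for `Q` at failure parameters `m ≥ m₀`**: ONE tree scheme (a `RandAlg`, so with a
polynomially BOUNDED — advice-carrying — coin budget) whose coin error about `x ∈ Q.yes` is `< 1/4` on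
every promise instance, at every `n` and every `m ≥ m₀`.  `m₀ = 1` is "at every `m > 0`" (the
hypothesis of the landed `pea_mem_HeurBPP_of_promiseScheme`); `m₀ = 2` is what `HeurBPP` actually
constrains (at `m = 1` the bound `≤ 1/1` is void). [BogdanovTrevisan2006, Def. 2.12;
AroraBarakCC2009, §6.3] -/
def HasPromiseSchemeFrom (m₀ : ℕ) (Q : PromiseProblem) : Prop :=
  ∃ A : RandAlg (List Bool × ℕ × ℕ) Bool, A.IsPolyTime schemeEnc encodeBool ∧
    ∀ (n m : ℕ), m₀ ≤ m → ∀ x : List Bool, (x ∈ Q.yes ∨ x ∈ Q.no) →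
      A.pr schemeEnc (x, n, m) {b | b ≠ Q.yes.boolIndicator x} < 1 / 4

/-- Monotonicity in `m₀`. [folklore] -/
theorem HasPromiseSchemeFrom.mono {m₀ m₁ : ℕ} (h : m₀ ≤ m₁) {Q : PromiseProblem}
    (hQ : HasPromiseSchemeFrom m₀ Q) : HasPromiseSchemeFrom m₁ Q := by
  obtain ⟨A, hA, hc⟩ := hQ
  exact ⟨A, hA, fun n m hm x hx => hc n m (h.trans hm) x hx⟩

/-- `PromiseBPP'` gives a promise scheme from `m₀ = 1` (amplify on the promise to error `≤ 1/8`, lift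
to scheme inputs: `exists_randAlg_promise_error_le`, `RandAlg.pr_schemeLift`; landed in general as
`promiseScheme_of_mem_PromiseBPP'`, `PeaWorstToAvgAdviceAsymmetry.lean`). [AroraBarakCC2009, Thm 7.10] -/
theorem hasPromiseSchemeFrom_one_of_mem (h : PEA 3 ∈ PromiseBPP') : HasPromiseSchemeFrom 1 (PEA 3) := by
  obtain ⟨A, hA, hq, hobl, herr⟩ :=
    exists_randAlg_promise_error_le (PEA_disjoint 3) h (by norm_num : (0 : ℝ) < 1 / 8)
  refine ⟨A.schemeLift, hA.schemeLift polyTimeComputable_schemeEnc_dropParams_holds,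
    fun n m _ x hx => ?_⟩
  rw [A.pr_schemeLift hq hobl]
  have := herr x hx
  linarith

/-- **A promise scheme from `m₀ = 2` already makes every on-promise ensemble easy** (at `m = 1` the
`HeurBPP` bound is void; at `m ≥ 2` the bad set misses the support). [BogdanovTrevisan2006, §2.3] -/
theorem mem_HeurBPP_of_hasPromiseSchemeFrom_two (h : HasPromiseSchemeFrom 2 (PEA 3)) (D : Ensemble)
    (hD : ∀ n : ℕ, ∀ w ∈ (D n).support, w ∈ (PEA 3).yes ∨ w ∈ (PEA 3).no) :
    (⟨(PEA 3).yes, D⟩ : DistProblem) ∈ HeurBPP := by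
  obtain ⟨A, hA, hcorr⟩ := h
  refine ⟨A, hA, fun n m hm => ?_⟩
  rcases Nat.lt_or_ge m 2 with hm2 | hm2
  · have hm1 : m = 1 := by omega
    subst hm1
    simpa using (D.prob_le_one n _)
  have hdisj : Disjoint (D n).support
      {x | 1 / 4 ≤ A.pr schemeEnc (x, n, m) {b | b ≠ (PEA 3).yes.boolIndicator x}} :=
    Set.disjoint_left.2 fun x hx hbad => absurd hbad (not_le.2 (hcorr n m hm2 x (hD n x hx)))
  change D.prob n {x | 1 / 4 ≤ A.pr schemeEnc (x, n, m) {b | b ≠ (PEA 3).yes.boolIndicator x}} ≤ 1 / m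
  rw [Ensemble.prob, (PMF.toOuterMeasure_apply_eq_zero_iff _ _).2 hdisj, ENNReal.toReal_zero]
  positivity

/-- **§5(b) The crux in the promise-scheme world**: a promise scheme (advice allowed, `m ≥ 2`) makes
`PeaWorstToAvg ↔ PEA 3 ∈ PromiseBPP'`. [AroraBarakCC2009, §6.3; DvirGutfreundRothblumVadhan2010, pp. 2–3] -/
theorem peaWorstToAvg_iff_mem_of_hasPromiseSchemeFrom_two (h : HasPromiseSchemeFrom 2 (PEA 3)) :
    PeaWorstToAvg ↔ PEA 3 ∈ PromiseBPP' := by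
  constructor
  · intro hc
    by_contra hB
    obtain ⟨D, -, hsupp, hD⟩ := szkEntropy_peaWorstToAvg_iff.1 hc hB
    exact hD (mem_HeurBPP_of_hasPromiseSchemeFrom_two h D hsupp)
  · intro hB
    exact szkEntropy_peaWorstToAvg_iff.2 fun hn => absurd hB hn

/-! ### §5b The quantifier-swapped crux is pure advice elimination -/

/-- **The WEAK (quantifier-swapped) crux**: under worst-case hardness, for EVERY scheme there is SOME
samplable on-promise ensemble on which that scheme fails the `HeurBPP` requirement (Gutfreund–
Shaltiel–Ta-Shma's "∀A ∃D_A" shape, [GutfreundShaltielTaShma2007], reported in [Hirahara2018, p. 21]).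
Implied by the crux (`weak_of_peaWorstToAvg`). [BogdanovTrevisan2006, Def. 2.12–2.13] -/
def PeaWorstToAvgWeak : Prop :=
  PEA 3 ∉ PromiseBPP' → ∀ A : RandAlg (List Bool × ℕ × ℕ) Bool, A.IsPolyTime schemeEnc encodeBool →
    ∃ D : Ensemble, D.IsPolySamplable ∧
      (∀ n : ℕ, ∀ w ∈ (D n).support, w ∈ (PEA 3).yes ∨ w ∈ (PEA 3).no) ∧
      ∃ n m : ℕ, 0 < m ∧ 1 / (m : ℝ) <
        D.prob n {x | 1 / 4 ≤ A.pr schemeEnc (x, n, m) {b | b ≠ (PEA 3).yes.boolIndicator x}}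

/-- The crux implies its quantifier-swapped form. [folklore] -/
theorem weak_of_peaWorstToAvg (h : PeaWorstToAvg) : PeaWorstToAvgWeak := by
  intro hB A hA
  obtain ⟨D, hS, hsupp, hD⟩ := szkEntropy_peaWorstToAvg_iff.1 h hB
  refine ⟨D, hS, hsupp, ?_⟩
  by_contra hno
  push Not at hno
  exact hD ⟨A, hA, fun n m hm => hno n m hm⟩

/-- **The weak crux is EXACTLY advice elimination for `PEA₃`.**
`PeaWorstToAvgWeak ↔ (PEA 3 ∉ PromiseBPP' → ¬ HasPromiseSchemeFrom 2 (PEA 3))`: (→) a promise scheme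
from `m₀ = 2` beats every on-promise ensemble (`mem_HeurBPP_of_hasPromiseSchemeFrom_two`); (←) if the
scheme `A` errs with probability `≥ 1/4` on the promise instance `x` at some `(n, m ≥ 2)`, the CONSTANT
point-mass ensemble `δ_x` (samplable: `isPolySamplable_const`) has bad-set mass `1 > 1/m` there.  In the
intended UNIFORM model the right-hand side is a tautology (a uniform scheme at fixed `(n, m)` is a
`PromiseBPP'`-candidate), so the weak crux is trivially true there; in the tree's model it is the open
advice-elimination statement "`coinLen`-advice does not help for `PEA₃`".  Hence the typed crux =
(DGRV's uniform ∃D∀A statement) ⊕ (advice elimination). [AroraBarakCC2009, §6.3; KarpLipton1982;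
BogdanovTrevisan2006, §2.3] -/
theorem weak_iff : PeaWorstToAvgWeak ↔ (PEA 3 ∉ PromiseBPP' → ¬ HasPromiseSchemeFrom 2 (PEA 3)) := by
  constructor
  · intro h hB hS
    obtain ⟨A, hA, hcorr⟩ := hS
    obtain ⟨D, -, hsupp, n, m, hm, hlt⟩ := h hB A hA
    have hmem := mem_HeurBPP_of_hasPromiseSchemeFrom_two ⟨A, hA, hcorr⟩ D hsupp
    -- the very scheme `A` witnesses membership, so its bad sets are small: contradiction with `hlt`?
    -- No: `hmem` only gives SOME scheme. Use `A` directly: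
    rcases Nat.lt_or_ge m 2 with hm2 | hm2
    · have hm1 : m = 1 := by omega
      subst hm1
      have := D.prob_le_one n
        {x | 1 / 4 ≤ A.pr schemeEnc (x, n, 1) {b | b ≠ (PEA 3).yes.boolIndicator x}}
      norm_num at hlt
      linarith
    · have hdisj : Disjoint (D n).support
          {x | 1 / 4 ≤ A.pr schemeEnc (x, n, m) {b | b ≠ (PEA 3).yes.boolIndicator x}} :=
        Set.disjoint_left.2 fun x hx hbad => absurd hbad (not_le.2 (hcorr n m hm2 x (hsupp n x hx)))
      have h0 : D.prob n {x | 1 / 4 ≤ A.pr schemeEnc (x, n, m)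
          {b | b ≠ (PEA 3).yes.boolIndicator x}} = 0 := by
        rw [Ensemble.prob, (PMF.toOuterMeasure_apply_eq_zero_iff _ _).2 hdisj, ENNReal.toReal_zero]
      rw [h0] at hlt
      have : (0 : ℝ) < 1 / (m : ℝ) := by positivity
      linarith
  · intro h hB A hA
    have hno : ¬ ∀ (n m : ℕ), 2 ≤ m → ∀ x : List Bool, (x ∈ (PEA 3).yes ∨ x ∈ (PEA 3).no) →
        A.pr schemeEnc (x, n, m) {b | b ≠ (PEA 3).yes.boolIndicator x} < 1 / 4 :=
      fun hall => h hB ⟨A, hA, hall⟩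
    push Not at hno
    obtain ⟨n, m, hm, x, hx, hbad⟩ := hno
    refine ⟨fun _ => PMF.pure x, isPolySamplable_const x, fun k w hw => ?_, n, m, by omega, ?_⟩
    · have : w = x := by simpa using hw
      rw [this]
      exact hx
    · have hmem : x ∈ {x | 1 / 4 ≤ A.pr schemeEnc (x, n, m) {b | b ≠ (PEA 3).yes.boolIndicator x}} :=
        hbad
      have h1 : Ensemble.prob (fun _ => PMF.pure x) n
          {x | 1 / 4 ≤ A.pr schemeEnc (x, n, m) {b | b ≠ (PEA 3).yes.boolIndicator x}} = 1 := by
        rw [Ensemble.prob, PMF.toOuterMeasure_pure_apply, if_pos hmem, ENNReal.toReal_one]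
      rw [h1]
      have hm' : (2 : ℝ) ≤ m := by exact_mod_cast hm
      rw [div_lt_one (by positivity)]
      linarith

/-- Corollary: under the crux's hypothesis, the crux itself already forbids promise schemes from
`m₀ = 2` (`weak_of_peaWorstToAvg` + `weak_iff`): a proof of the typed crux must in particular show that
`O(log)`-advice does not decide `PEA₃`. [AroraBarakCC2009, §6.3] -/
theorem not_hasPromiseSchemeFrom_two_of_peaWorstToAvg (h : PeaWorstToAvg) (hB : PEA 3 ∉ PromiseBPP') :
    ¬ HasPromiseSchemeFrom 2 (PEA 3) :=
  weak_iff.1 (weak_of_peaWorstToAvg h) hB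

/-! ## §6 Printed landmarks (REMARK)

* CONCLUSION ⇒ OWF: a hard-on-average problem in SZK on a samplable distribution gives one-way
  functions [Ostrovsky1991] (cited by the item; commentary, not in the cone).  HYPOTHESIS ⇒ only
  AUXILIARY-INPUT one-way functions [OstrovskyWigderson1993]; via [AllenderDas2017] this already gives
  `MCSP, MKTP ∉ BPP` ("the best known worst-case hardness result for MCSP … is SZK-hardness, proved by
  inverting some auxiliary-input one-way function", [Hirahara2018, p. 23]).  So the crux asks to upgrade
  `SZK_L ⊄ BPP ⇒ ai-OWF` to a FIXED samplable hard distribution — equivalently (given Ostrovsky and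
  HILL) to `SZK_L ⊄ BPP ⇒ OWF`, a recognised open problem; no printed refutation or barrier targets it.
* BLACK-BOX BARRIER is VACUOUS here: "if a language L reduces to a distributional NP problem via a
  black-box nonadaptive randomized polynomial-time reduction, then L ∈ NP/poly ∩ coNP/poly"
  [BogdanovTrevisan2006; Hirahara2018, p. 20]; `PEA₃ ∈ AM ∩ coAM` already, so Feigenbaum–Fortnow /
  Bogdanov–Trevisan / Akavia–Goldreich–Goldwasser–Moshkovitz exclude nothing (the catalogued
  `Literature.Barriers.PneNP.NPHardnessToOneWayFunctions` does not bite, as the route states).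
* QUANTIFIER SWAP: "for every polynomial-time algorithm A trying to compute SAT, there exists an
  efficiently samplable distribution D_A under which A fails … D_A depends on a source code of A"
  [GutfreundShaltielTaShma2007; Hirahara2018, p. 21] — uses SAT's search-to-decision structure; for
  `PEA₃` (no known downward/search self-reduction) even this ∀A∃D form is not in print, and in the tree's
  model it is LITERALLY advice elimination (§5b `weak_iff`).
* RELATIVISED HEURISTICA: "Impagliazzo [36] constructed an oracle A such that DistNP^A ⊆ AvgP^A and
  NP^A ∩ coNP^A ⊄ P^A/poly" [Impagliazzo2011 CCC pp. 104–114; Hirahara2018, p. 25]; Impagliazzo's survey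
  itself: "there is an oracle in which every problem in NP has an algorithm that solves it on most
  instances, yet NP ⊄ P/poly" [Impagliazzo1995, p. 6].  The crux concerns ONE explicit algebraic problem,
  so relativisation is not a formal barrier, but every GENERIC worst-to-average argument (one that would
  work for an arbitrary `SZK_L`-complete oracle problem) is blocked: a proof must use the cubic-map
  structure (the route's stated intent: `GL_n × GL_m` orbits, direct products, equidistribution).
* NO BLACK-BOX average-case SZK hardness from OWF [BitanskyDegwekarVaikuntanathan2017/2021] (cited by the
  route): so the ∃D cannot be imported from Minicrypt generically either; the landed card files
  (`…DualMode*.lean`, `…Reductions.lean`) correctly CONDITION on a dual-mode / lossy pair or on a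
  reducible hard problem (lattices) — inputs that are themselves at least as strong as the conclusion.
-/
theorem printedLandmarks : True := trivial

/-! ## §7 Regimes tried for the ∃D (REMARK; small-model computation kit job j009530)

* RANDOM SPARSE CUBIC MAPS `p : F₂ⁿ → F₂ⁿ` (each output a XOR of `T` random monomials): expected output
  entropy `≈ n − 0.83` (the random-function value `Σ_k e^{-1} k log₂ k / k!`), so with threshold `k = n−2`
  they are YES instances w.h.p. — a ONE-SIDED ensemble, easy by §4 (`pea_mem_HeurBPP_of_support_subset_
  yes`).  [numbers: kit job j009530, `py/random_cubic_entropy.py` (n = 10, 12, 14; random vs planted), QUEUED at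
  publication time behind ~1900 jobs; its summary is attached to the item automatically (`--workitem`) and will
  be folded in at the next re-arm — the `≈ n − 0.83` figure is the random-function heuristic, to be confirmed; gen 3: the job is owned by
  the g2 identity and its output is not readable from this seat — figure UNCONFIRMED, immaterial for the picked line]
* PLANTED KERNEL `p = q ∘ M`, `rank M = n − c`: entropy `≤ n − c` (NO for `k = n − 2`, `c = 3`), two-sided
  together with the random maps — but DETECTABLE in polynomial time: `ker M` lies in the left kernel of
  the `n × (m·C(n,2))` flattening of the cubic part of `p` (the `x`-degree-2 part of `p(x+v) − p(x)` is
  `Σ_a v_a ∂_a p₃`, linear in `v`), so Gaussian elimination separates planted (rank `≤ n − c`) from random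
  (rank `n`) [job j009530 checks both ranks].  Degree bookkeeping (`deg(q ∘ g) ≤ deg q · deg g ≤ 3`) shows
  every COMPOSITIONAL planting inside degree 3 is of this linear type; entropy deficiency invisible to
  linear algebra must come from non-compositional collision structure (shared factors, AIK-type
  encodings `H(p̂) = H(f(U)) + |r|` whose description REVEALS the branching program of `f` — hiding it is
  an obfuscation task, cf. the BDV black-box separation in §6).
* POINT MASSES / DIAGONALISATION: `δ_{x_n}` ensembles are samplable only for `x_n` computable in
  `poly(n)` time from `O(log n)` advice bits (`isPolySamplable_pure_singleton`), while the instances on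
  which a given scheme errs are only guaranteed to EXIST (hypothesis) — findable in exponential, not
  polynomial, time; and a scheme gets time `poly(n + m)`, exponential in `|x|` whenever `|x| = O(log n)`,
  enough to brute-force `H` (entropy depends only on the `≤ |x|` variables that occur).  So neither
  "universal" nor diagonal ensembles can witness the ∃D; cf. §5b.
-/
theorem regimesTried : True := trivial


/-! ## §8 TARGETS — line `dual-mode-compile` (PICKED 2026-08-16; skeleton fd0625e15dd7, six stubs)

Generation 3 (refuter-cdisprove-stmt-PneNP-10777-g3-0).  Status of the six registered stubs under attack:

* `stub_modeEncoding : Nonempty ModeKit` (closing, research-level).  NO KILL POSSIBLE short of thesis X: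
  `PEA 3 ∈ PromiseBPP' → Nonempty ModeKit` (drefute, `Cruxes/PeaWorstToAvg/DrefuteCalibration.lean`:
  constant certified samplers + `selectEnc` of the amplified promise decider), so `¬ STUB1 → PeaThreeNotInP`.
  What gen 3 adds are NECESSARY CONDITIONS on the encoder, as theorems (§8.2, all sorry-free; PMF-level
  versions LANDED/PROPOSED as `Theorems/PeaWorstToAvg/Negative/PeaWorstToAvgModeKitObstructions.lean`):
  (a) NO EXACT INVARIANT: an encoder `1/16`-close per length to one certified law cannot transport any
  invariant exactly unless that invariant is constant on the yes-instances of each length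
  (`ModeKitOver.exactInvariant_const`); concretely NO ENTROPY-EXACT encoder (up to any shift of the length):
  the yes-instances `(x ↦ (x₂,x₃), 0)`, `(x ↦ (x₂,x₂), 0)` on `F₂⁴` have equal code length and entropies
  `2 ≠ 1` (`ModeKitOver.not_entropyExact`) — this is barrier B1/B2 / old §6 for THIS interface, and it kills
  GL/affine re-randomisation, direct sums/products with fixed gadgets, AIK re-encoding of the given map and all
  their compositions as candidate `enc`; in the domination form (gen-2 planner kit, factor `dom`) the same
  argument bounds the number of exactly-served invariant classes per length by `dom/(1-slack)`
  (`card_mul_le_of_dominated_classes`), and the ROBUST form (`not_mostly_separated`,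
  `card_mul_le_of_dominated_classes'`): classes hit only with probability `≥ 1-η` still number
  `≤ dom/(1-η-slack)`, two disjoint target classes for the two witnesses are impossible once `η + ε < 1/2`;
  and quantitatively ANY two same-length yes-instances have encodings within TV `2ε = 1/8`
  (`enc_merges_yes`) while a yes/no pair is `≥ 7/8` apart (b); TIGHTNESS of the interface: at `ε = 1/2` a kit is trivial (oblivious fair mixture of the two samplers as
  `enc`; drefute: `slack < 1/2` sharp), and `stub_decider`'s analysis needs `ε < 1/3`; (b) SEPARATION: `enc`'s laws on a yes- and a no-instance of one
  length are `≥ 7/8` apart in total variation (`ModeKitOver.enc_separates`) — `enc` is a statistical decision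
  procedure (SRE correctness), so "hiding" must come entirely from computational/structural mixing INSIDE each
  side; (c) RANDOMNESS IS LOAD-BEARING: a coin-free encoder is constant on the yes- (resp. no-) instances of
  each length, its value a `15/16`-atom of `samp true` (resp. `samp false`) (`ModeKitOver.det_collapse`,
  `ModeKitOver.det_heavyAtom`) — then `x ↦ [enc x = a fresh sample of samp true]` decides `PEA₃` in
  `PromiseBPP'`, so under `A` the encoder uses coins (an `O(log)`-coin encoder is likewise excluded on paper:
  its whole law is computable in polynomial time and `TV(enc x, samp true)` is estimable by sampling).
* `stub_canon`, `stub_blockPerf` (provable).  ESSENTIALLY IN THE TREE since 02:10–02:26 today: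
  `RandPoly.eq_shiftU_mul_canon_mul_colV` (`M = U(M)·C_{δ(M)}·V(M)` for every `IsBPShape M`, with
  `unshiftU_mul_shiftU`, `colV_isLastCol`, `IsLastCol.mul_self`) is `stub_canon` up to `corner M = M.det`
  (Laplace along row `0` of `canon δ`; over `F₂` no signs), and `RandPoly.perfExt_gBlock` is `stub_blockPerf`
  up to the same identity, because the skeleton's `blockOf`/`entryOf` ARE `RandPoly.gBlock`/`gEntry`
  (`blockOf_eq_gBlock : blockOf = RandPoly.gBlock := rfl`, §8.4).  No attack left; the determinant
  identity is PROVED here too (§8.4: `CornerDet.det_canon`, `CornerDet.corner_eq_det`; attached as item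
  evidence `CornerDet.lean` and proposed as `Literature/…/RandomizingPolynomialsCornerDet.lean`) — so
  `stub_canon` and `stub_blockPerf` are now assembly exercises over tree theorems.
* `stub_compile (hblock) : BPEA ≤ₚ PEA 3` (provable, XL).  `hblock` is satisfiable (it is `perfExt_gBlock`'s
  conclusion), so the stub is not vacuous; `RandPoly.perfExt_encodeBDDs` (tree, 02:26) already gives the
  perfect encoding of LISTS of general BDDs — the semantic half of the compile; the `FP` machine half remains.
  Degenerate cases checked on paper: empty program (`det` of the `0×0` matrix `= 1`, a constant output,
  entropy `+0`), unused input variables (entropy of the output law is unaffected), labels with repeated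
  variables (cancel in pairs, `AffLabel.eval`).  No attack.
* `stub_adviceElim` (provable, L).  Its CERTIFICATION hypotheses are LOAD-BEARING — THEOREM (§8.3,
  `adviceElim_false_without_labels`, LANDED/PROPOSED p76978 as
  `Theorems/PeaWorstToAvg/Negative/AdviceElimFalseWithoutLabels.lean`): with `h₀`/`h₁` dropped the statement
  is FALSE, unconditionally, because `UHeurBPP ⊊ HeurBPP` already on the samplable ensemble `δ_{1ⁿ}`
  (`exists_sizeClass_heurBPP_not_uniform`: size-class languages are `HeurBPP`-easy via `coinLen` advice,
  `mem_HeurBPP_sizeClass`, while uniform schemes are COUNTABLE, `countable_uniformSchemes`, and a uniform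
  scheme on `δ_{1ⁿ}` determines the language, `schemeKey_eq`).  So any proof must TEST candidates on labelled
  samples (the skeleton's plan); generic "uniformisation" shortcuts are dead.  The SAMPLABILITY of the two
  components is load-bearing AS WELL — THEOREM `adviceElim_false_without_samplability` (§8.5; labels kept,
  `K₀ ⊆ Q.no`, `K₁ ⊆ Q.yes` arbitrary ensembles: FALSE, by interleaving `a(3t)=1, a(3t+1)=0, a(3t+2)=c t`;
  both theorems proposed as `Theorems/PeaWorstToAvg/Negative/AdviceElimLoadBearing.lean`, p77449, superseding
  p76978 which the gate restart bounced).  The statement itself: no counterexample; the self-testing proof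
  sketch checks out on paper INCLUDING the two traps of the model (the true candidate's labelled error is only
  `< 1/4 + 1/m'` before amplification — amplify first; `U`'s coin budget must be a polynomial of
  `|⟨y,1ⁿ,1ᵐ⟩|` alone — pad to a fixed polynomial and ignore inputs `y` longer than the samplers' range).
* `stub_decider` (provable, M–L).  Irrefutable short of `X ∧ Nonempty ModeKit` (drefute calibration:
  `¬ STUB4 → Nonempty ModeKit ∧ PEA 3 ∉ PromiseBPP'`); per-run success `≥ 87/128` re-derived; the
  `PromiseBPP'` coin polynomial `t·(encCoins(|x|) + max_{|y| ≤ T_enc(|x|)} c_U(|⟨y,1^{|x|},1^{64}⟩|))` is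
  well-defined because `ℕ[X]`-budgets are monotone.  No attack.
-/

/-! ### §8.1 The mode kit over an arbitrary certified target (the skeleton's `ModeKit` is the case
`T = BPEA`, `ε = 1/16`, field for field) -/

/-- **Mode kit over a target promise problem `T` with slack `ε`** — verbatim the fields of the skeleton's
`ModeKit` (`Lines/dual-mode-compile.lean` §1) with `BPEA` replaced by a parameter `T` and `1/16` by `ε`:
certified uniform samplers `samp false ⊆ T.no`, `samp true ⊆ T.yes` with a common polynomial coin budget,
and ONE uniform randomized encoder `enc` whose law on every yes- (resp. no-) instance `x` of `PEA 3` is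
`ε`-close from above, event by event, to the law of `samp true` (resp. `samp false`) on `1^{|x|}`.  Every
`kit : ModeKit` of the skeleton gives `⟨kit.samp, …, kit.enc_no⟩ : ModeKitOver BPEA (1/16)` by copying
fields, so each theorem below applies to the registered closing stub. [ApplebaumRaykov2016, Def. of SRE;
PeikertWaters2008; FeigenbaumFortnow1993] -/
structure ModeKitOver (T : PromiseProblem) (ε : ℝ) where
  /-- certified sampler of mode `b` on input `1ⁿ` -/
  samp : Bool → RandAlg ℕ (List Bool)
  samp_polyTime : ∀ b, (samp b).IsPolyTime unaryEncodeNat (id : List Bool → List Bool)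
  /-- its coin budget is this polynomial of the input length (uniformity) -/
  sampCoins : Polynomial ℕ
  samp_coinLen : ∀ b ℓ, (samp b).coinLen ℓ = sampCoins.eval ℓ
  samp_no : ∀ n, ∀ w ∈ ((samp false).outputPMF unaryEncodeNat n).support, w ∈ T.no
  samp_yes : ∀ n, ∀ w ∈ ((samp true).outputPMF unaryEncodeNat n).support, w ∈ T.yes
  /-- the mode-preserving randomized encoder on instance strings -/
  enc : RandAlg (List Bool) (List Bool)
  enc_polyTime : enc.IsPolyTime (id : List Bool → List Bool) (id : List Bool → List Bool)
  encCoins : Polynomial ℕ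
  enc_coinLen : ∀ ℓ, enc.coinLen ℓ = encCoins.eval ℓ
  enc_yes : ∀ x ∈ (PEA 3).yes, ∀ E : Set (List Bool),
    enc.pr id x E ≤ (samp true).pr unaryEncodeNat x.length E + ε
  enc_no : ∀ x ∈ (PEA 3).no, ∀ E : Set (List Bool),
    enc.pr id x E ≤ (samp false).pr unaryEncodeNat x.length E + ε

/-! ### §8.2 Obstruction calculus (PMF level; = the proposed Negative file, kept here until it is built) -/

namespace Obstruction

/-! The PMF-level calculus is LANDED (`Theorems/PeaWorstToAvg/Negative/PeaWorstToAvgModeKitObstructions.lean`,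
p77376; imported above, namespace `Summit.PneNP.PneNP.Theorems`): `toOuterMeasure_add_compl_eq_one`,
`toReal_toOuterMeasure_add_compl`, `sum_toReal_toOuterMeasure_le_one`, `card_mul_le_of_dominated_classes`
(invariant counting, domination form), `not_close_of_carried_disjoint`, `eq_of_close_of_carried`,
`sub_le_of_close_to_separated`, `toReal_toOuterMeasure_eq_zero_of_support_subset`, `le_apply_of_atom_close`,
`le_apply_of_pure_close`, `pure_eq_of_close`, the PEA witnesses (`projFour_eq_prod`, `dupFour_eq_prod`,
`entropy_idTwo/idOne/projTwo/dupTwo`, `entropy_peaProjInst = 2`, `entropy_peaDupInst = 1`,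
`encode_peaProjInst_mem_yes`, `encode_peaDupInst_mem_yes`, `length_encode_peaProjInst_eq`) and
`pea_no_entropyExact_encoder`, `pea_exactInvariant_eq_on_witnesses`.  The ROBUST forms below are proposed as a
whole-file extension (p78400: `card_mul_le_of_dominated_classes'`, `not_close_of_mostly_carried_disjoint`,
`pea_not_mostly_separated_witnesses`) and kept here under `_robust` names until that lands. -/

variable {α : Type*}

/-- **Invariant counting, robust form**: events hit with probability `≥ 1 - η` (instead of surely) still
number `≤ d/(1-η-ε)`. [BogdanovTrevisan2006, Def. 3.1; FeigenbaumFortnow1993] -/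
theorem card_mul_le_of_dominated_classes_robust {ι : Type*} (q : PMF α) (S : Finset ι) (p : ι → PMF α)
    (E : ι → Set α) {d ε η : ℝ} (hd : 0 ≤ d) (hdisj : (S : Set ι).PairwiseDisjoint E)
    (hcar : ∀ i ∈ S, 1 - η ≤ ((p i).toOuterMeasure (E i)).toReal)
    (hdom : ∀ i ∈ S, ∀ F : Set α,
      ((p i).toOuterMeasure F).toReal ≤ d * (q.toOuterMeasure F).toReal + ε) :
    (S.card : ℝ) * (1 - η - ε) ≤ d := by
  have hsum : ∑ i ∈ S, ((p i).toOuterMeasure (E i)).toReal ≤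
      ∑ i ∈ S, (d * (q.toOuterMeasure (E i)).toReal + ε) :=
    Finset.sum_le_sum fun i hi => hdom i hi (E i)
  have hlow : ∑ i ∈ S, (1 - η) ≤ ∑ i ∈ S, ((p i).toOuterMeasure (E i)).toReal :=
    Finset.sum_le_sum fun i hi => hcar i hi
  rw [Finset.sum_const, nsmul_eq_mul] at hlow
  rw [Finset.sum_add_distrib, Finset.sum_const, nsmul_eq_mul, ← Finset.mul_sum] at hsum
  have hq := sum_toReal_toOuterMeasure_le_one q S E hdisj
  have : d * ∑ i ∈ S, (q.toOuterMeasure (E i)).toReal ≤ d * 1 := mul_le_mul_of_nonneg_left hq hd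
  nlinarith

/-- **Two APPROXIMATELY transported classes kill a TV-close encoder** once `η + ε < 1/2`. [folklore] -/
theorem not_close_of_mostly_carried_disjoint_robust (q p₁ p₂ : PMF α) {E₁ E₂ : Set α} {ε η : ℝ}
    (hεη : η + ε < 1 / 2) (hdisj : Disjoint E₁ E₂) (hc₁ : 1 - η ≤ (p₁.toOuterMeasure E₁).toReal)
    (hc₂ : 1 - η ≤ (p₂.toOuterMeasure E₂).toReal)
    (h₁ : ∀ F : Set α, (p₁.toOuterMeasure F).toReal ≤ (q.toOuterMeasure F).toReal + ε)
    (h₂ : ∀ F : Set α, (p₂.toOuterMeasure F).toReal ≤ (q.toOuterMeasure F).toReal + ε) : False := by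
  classical
  have h := card_mul_le_of_dominated_classes_robust (ι := Bool) q Finset.univ (fun b => if b then p₁ else p₂)
    (fun b => if b then E₁ else E₂) (d := 1) (ε := ε) (η := η) zero_le_one ?_ ?_ ?_
  · simp only [Finset.card_univ, Fintype.card_bool, Nat.cast_ofNat] at h
    linarith
  · intro a _ b _ hab
    cases a <;> cases b <;> simp_all [Function.onFun, disjoint_comm]
  · intro b _
    cases b
    · exact hc₂
    · exact hc₁
  · intro b _ F
    cases b <;> simpa using (by first | exact h₂ F | exact h₁ F)

/-- Entropies of the two witnesses: `2` and `1` (landed `entropy_peaProjInst`, `entropy_peaDupInst`). -/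
theorem entropy_witnesses :
    PolyMapF2.entropy (⟨4, ([[[2]], [[3]]], 0)⟩ : PEAInst).2.1 = 2 ∧
      PolyMapF2.entropy (⟨4, ([[[2]], [[2]]], 0)⟩ : PEAInst).2.1 = 1 :=
  ⟨entropy_peaProjInst, entropy_peaDupInst⟩

/-- The two witnesses have codes of the same length (landed `length_encode_peaProjInst_eq`). -/
theorem length_encode_witnesses_eq :
    (PEAInst.encoding.encode (⟨4, ([[[2]], [[3]]], 0)⟩ : PEAInst)).length =
      (PEAInst.encoding.encode (⟨4, ([[[2]], [[2]]], 0)⟩ : PEAInst)).length :=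
  length_encode_peaProjInst_eq

end Obstruction

/-! ### §8.3 What the encoder of a mode kit cannot be (instantiation for `ModeKitOver T ε`) -/

namespace ModeKitOver

variable {T : PromiseProblem} {ε : ℝ} (kit : ModeKitOver T ε)

/-- The closeness field on the yes side, PMF form (`RandAlg.pr` unfolds to it). [folklore] -/
theorem close_yes (x : List Bool) (hx : x ∈ (PEA 3).yes) (F : Set (List Bool)) :
    ((kit.enc.outputPMF id x).toOuterMeasure F).toReal ≤
      (((kit.samp true).outputPMF unaryEncodeNat x.length).toOuterMeasure F).toReal + ε :=
  kit.enc_yes x hx F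

/-- The closeness field on the no side, PMF form. [folklore] -/
theorem close_no (x : List Bool) (hx : x ∈ (PEA 3).no) (F : Set (List Bool)) :
    ((kit.enc.outputPMF id x).toOuterMeasure F).toReal ≤
      (((kit.samp false).outputPMF unaryEncodeNat x.length).toOuterMeasure F).toReal + ε :=
  kit.enc_no x hx F

/-- **(a) NO EXACT INVARIANT.** If `ε < 1/2` and the encoder carries every yes-instance `x` surely into the
class `{w | inv w = val x}` of some target invariant `inv`, then `val` is CONSTANT on the yes-instances of
each length (GL/affine orbit, isomorphism class, rank profile, entropy-up-to-shift … : none is transported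
exactly by a kit's encoder unless it forgets everything but the length). [FeigenbaumFortnow1993;
ApplebaumRaykov2016, Thm. 1] -/
theorem exactInvariant_const (hε : ε < 1 / 2) {β : Type*} (inv val : List Bool → β)
    (hexact : ∀ x ∈ (PEA 3).yes, kit.enc.pr id x {w | inv w = val x} = 1)
    {x x' : List Bool} (hx : x ∈ (PEA 3).yes) (hx' : x' ∈ (PEA 3).yes) (hlen : x.length = x'.length) :
    val x = val x' :=
  eq_of_close_of_carried ((kit.samp true).outputPMF unaryEncodeNat x'.length) (kit.enc.outputPMF id x)
    (kit.enc.outputPMF id x') inv hε (hexact x hx) (hexact x' hx')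
    (fun F => by simpa only [hlen] using kit.close_yes x hx F) (kit.close_yes x' hx')

/-- **(a′) NO ENTROPY-EXACT ENCODER.** For `ε < 1/2`, NO readout `Ht` of target entropy and NO shift
`s` of the length make `enc x` surely of target entropy `H(x) + s |x|` for all yes-instances `x` (`Hs` any
function reading the true entropy off instance codes): the witnesses `(x ↦ (x₂,x₃), 0)` (entropy `2`) and
`(x ↦ (x₂,x₂), 0)` (entropy `1`) on `F₂⁴` have the same code length.  Barrier B1/B2 (old §6) for THIS
interface: entropy-exact moves — `GL`/affine re-randomisation, direct sums/products with fixed gadgets,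
perfect (AIK) re-encodings of the given map, and their compositions — are not mode kits.
[DvirGutfreundRothblumVadhan2010, pp. 2–3; ApplebaumRaykov2016, Thm. 1; FeigenbaumFortnow1993] -/
theorem not_entropyExact (hε : ε < 1 / 2) (Hs : List Bool → ℝ)
    (hHs : ∀ I : PEAInst, Hs (PEAInst.encoding.encode I) = PolyMapF2.entropy I.2.1)
    (Ht : List Bool → ℝ) (s : ℕ → ℝ) :
    ¬ ∀ x ∈ (PEA 3).yes, kit.enc.pr id x {w | Ht w = Hs x + s x.length} = 1 := by
  intro hexact
  have h := kit.exactInvariant_const hε Ht (fun x => Hs x + s x.length) hexact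
    (encode_peaProjInst_mem_yes (by norm_num)) (encode_peaDupInst_mem_yes (by norm_num))
    Obstruction.length_encode_witnesses_eq
  simp only [hHs, Obstruction.entropy_witnesses.1, Obstruction.entropy_witnesses.2,
    Obstruction.length_encode_witnesses_eq] at h
  linarith


/-- **(a″) … nor approximately.** If `η + ε < 1/2`, the encoder cannot send the two witnesses into DISJOINT
target classes `C₁`, `C₂` each with probability `≥ 1 - η` (e.g. "target entropy within `±1/4` of
`H(x) + s(|x|)` except with probability `η`"). [ApplebaumRaykov2016, Thm. 1; FeigenbaumFortnow1993] -/
theorem not_mostly_separated {η : ℝ} (hη : η + ε < 1 / 2) {C₁ C₂ : Set (List Bool)} (hC : Disjoint C₁ C₂)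
    (h₁ : 1 - η ≤ kit.enc.pr id (PEAInst.encoding.encode (⟨4, ([[[2]], [[3]]], 0)⟩ : PEAInst)) C₁)
    (h₂ : 1 - η ≤ kit.enc.pr id (PEAInst.encoding.encode (⟨4, ([[[2]], [[2]]], 0)⟩ : PEAInst)) C₂) :
    False :=
  Obstruction.not_close_of_mostly_carried_disjoint_robust
    ((kit.samp true).outputPMF unaryEncodeNat
      (PEAInst.encoding.encode (⟨4, ([[[2]], [[2]]], 0)⟩ : PEAInst)).length) _ _ hη hC h₁ h₂
    (fun F => by simpa only [Obstruction.length_encode_witnesses_eq] using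
      kit.close_yes _ (encode_peaProjInst_mem_yes (by norm_num)) F)
    (kit.close_yes _ (encode_peaDupInst_mem_yes (by norm_num)))


/-- Two-sided closeness: the one-sided field bounds give `|enc.pr x E - (samp true).pr E| ≤ ε`
(apply the field to `E` and to `Eᶜ`). [folklore] -/
theorem abs_sub_le_of_yes (x : List Bool) (hx : x ∈ (PEA 3).yes) (E : Set (List Bool)) :
    |kit.enc.pr id x E - (kit.samp true).pr unaryEncodeNat x.length E| ≤ ε := by
  have h1 := kit.enc_yes x hx E
  have h2 := kit.enc_yes x hx Eᶜ
  have h3 := toReal_toOuterMeasure_add_compl (kit.enc.outputPMF id x) E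
  have h4 := toReal_toOuterMeasure_add_compl ((kit.samp true).outputPMF unaryEncodeNat x.length) E
  unfold RandAlg.pr at h1 h2 ⊢
  rw [abs_sub_le_iff]
  constructor <;> linarith

/-- **(a‴) SAME-SIDE INSTANCES ARE STATISTICALLY MERGED.** The encodings of ANY two yes-instances of one
length are within `2ε` in total variation (`1/8` for the registered kit) — while by (b) a yes- and a
no-instance are `≥ 1 - 2ε` apart: `enc` is a `(2ε, 1-2ε)` statistical classifier-embedding that must
forget everything about a yes-instance but its length (quantitative form of (a)).
[ApplebaumRaykov2016, Def. of SRE (privacy); FeigenbaumFortnow1993] -/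
theorem enc_merges_yes {x x' : List Bool} (hx : x ∈ (PEA 3).yes) (hx' : x' ∈ (PEA 3).yes)
    (hlen : x.length = x'.length) (E : Set (List Bool)) :
    |kit.enc.pr id x E - kit.enc.pr id x' E| ≤ 2 * ε := by
  have h1 := kit.abs_sub_le_of_yes x hx E
  have h2 := kit.abs_sub_le_of_yes x' hx' E
  rw [hlen] at h1
  rw [abs_sub_le_iff] at h1 h2 ⊢
  constructor <;> linarith [h1.1, h1.2, h2.1, h2.2]

/-- **(b) THE ENCODER SEPARATES THE PROMISE.** If `T` is disjoint, the encoder's laws on a yes- and a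
no-instance of the same length differ by `≥ 1 - 2ε` on the event `T.no` (`7/8` at `ε = 1/16`): `enc` is a
statistical decision procedure for `PEA₃` (SRE correctness), so all "hiding" is inside each side.
[ApplebaumRaykov2016, Thm. 1 and 3] -/
theorem enc_separates (hT : T.Disjoint) {x x' : List Bool} (hx : x ∈ (PEA 3).yes) (hx' : x' ∈ (PEA 3).no)
    (hlen : x.length = x'.length) :
    1 - 2 * ε ≤ kit.enc.pr id x' T.no - kit.enc.pr id x T.no := by
  have hY : (((kit.samp true).outputPMF unaryEncodeNat x'.length).toOuterMeasure T.no).toReal = 0 :=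
    toReal_toOuterMeasure_eq_zero_of_support_subset _ (kit.samp_yes x'.length) hT
  have hN : (((kit.samp false).outputPMF unaryEncodeNat x'.length).toOuterMeasure T.noᶜ).toReal = 0 :=
    toReal_toOuterMeasure_eq_zero_of_support_subset _ (kit.samp_no x'.length) disjoint_compl_right
  exact sub_le_of_close_to_separated (kit.enc.outputPMF id x) (kit.enc.outputPMF id x')
    ((kit.samp true).outputPMF unaryEncodeNat x'.length)
    ((kit.samp false).outputPMF unaryEncodeNat x'.length) T.no hY hN
    (fun F => by simpa only [hlen] using kit.close_yes x hx F) (kit.close_no x' hx')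

/-- A coin-free `RandAlg` outputs the point mass at `run x []`. [AroraBarak2009, §7.1] -/
theorem outputPMF_eq_pure_of_coinLen_zero (A : RandAlg (List Bool) (List Bool)) (h0 : ∀ ℓ, A.coinLen ℓ = 0)
    (x : List Bool) : A.outputPMF id x = PMF.pure (A.run x []) := by
  unfold RandAlg.outputPMF
  have hnil : ∀ r : List.Vector Bool (A.coinLen (id x).length), r.toList = [] := fun r =>
    List.eq_nil_of_length_eq_zero (by rw [List.Vector.toList_length, h0])
  rw [show (fun r : List.Vector Bool (A.coinLen (id x).length) => A.run x r.toList) = fun _ => A.run x []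
    from funext fun r => by rw [hnil r]]
  exact PMF.map_const _ _

/-- **(c) DETERMINISTIC ENCODERS COLLAPSE.** If the encoder reads no coins and `ε < 1/2`, it is CONSTANT on
the yes-instances of each length (and on the no-instances): `enc.run x [] = enc.run x' []`.
[ApplebaumRaykov2016, Thm. 3] -/
theorem det_collapse (hε : ε < 1 / 2) (h0 : ∀ ℓ, kit.enc.coinLen ℓ = 0) {x x' : List Bool}
    (hx : x ∈ (PEA 3).yes) (hx' : x' ∈ (PEA 3).yes) (hlen : x.length = x'.length) :
    kit.enc.run x [] = kit.enc.run x' [] := by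
  refine pure_eq_of_close ((kit.samp true).outputPMF unaryEncodeNat x'.length) _ _ hε ?_ ?_
  · intro F
    rw [← outputPMF_eq_pure_of_coinLen_zero kit.enc h0 x]
    simpa only [hlen] using kit.close_yes x hx F
  · intro F
    rw [← outputPMF_eq_pure_of_coinLen_zero kit.enc h0 x']
    exact kit.close_yes x' hx' F

/-- **(c′) … onto a heavy atom of the certified law**: the common value `enc.run x []` of a coin-free encoder
on the yes-instances of length `|x|` is a `(1-ε)`-atom of `samp true (1^{|x|})` — so `x ↦ [enc.run x [] = a
fresh sample of samp true (1^{|x|})]` decides `PEA₃` with error `≤ ε` (two-sided, by (b)): `PEA 3 ∈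
PromiseBPP'`.  Under the crux's hypothesis a kit's encoder must therefore be genuinely randomized.
[ApplebaumRaykov2016, Thm. 3; Goldreich2006, Def. 1.2] -/
theorem det_heavyAtom (h0 : ∀ ℓ, kit.enc.coinLen ℓ = 0) {x : List Bool} (hx : x ∈ (PEA 3).yes) :
    1 - ε ≤ (((kit.samp true).outputPMF unaryEncodeNat x.length) (kit.enc.run x [])).toReal := by
  refine le_apply_of_pure_close _ _ fun F => ?_
  rw [← outputPMF_eq_pure_of_coinLen_zero kit.enc h0 x]
  exact kit.close_yes x hx F

end ModeKitOver

/-! ### §8.4 `stub_blockPerf` is `RandPoly.perfExt_gBlock` up to `corner = det` -/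

/-- Verbatim the skeleton's `entryOf` (§1 of `Lines/dual-mode-compile.lean`). [IshaiKushilevitz2002, §3] -/
def entryOf (n₀ d : ℕ) (Lsym : ℕ → ℕ → List (List ℕ)) (i k : ℕ) : List (List ℕ) :=
  (List.range (d + 1)).flatMap fun j => (List.range (d + 1)).flatMap fun l =>
    RandPoly.mulP (RandPoly.mulP (RandPoly.symR1 n₀ i j) (Lsym j l)) (RandPoly.symR2 n₀ d l k)

/-- Verbatim the skeleton's `blockOf`. [IshaiKushilevitz2002, §3; ApplebaumIshaiKushilevitz2006, §4.2] -/
def blockOf (n₀ d : ℕ) (Lsym : ℕ → ℕ → List (List ℕ)) : List (List (List ℕ)) :=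
  (RandPoly.pairsLE d).map fun ik => entryOf n₀ d Lsym ik.1 ik.2

/-- **The skeleton's block IS the tree's generic block** (definitional): so `stub_blockPerf` =
`RandPoly.perfExt_gBlock` (tree, `RandomizingPolynomialsGenericBlock.lean`, 2026-08-16) applied to
`X v := Matrix.of fun j l => evalP v (Lsym j l)` (BP shape from the two syntactic hypotheses; `AgreeBelow n₀`
dependence from the third), composed with the identity `corner (X v) = (X v).det` — the only piece not yet in
the tree (Laplace expansion of `det (canon δ)` along row `0`; no signs over `F₂`).  Likewise `stub_canon` =
`RandPoly.eq_shiftU_mul_canon_mul_colV` + `unshiftU_mul_shiftU` + `IsLastCol.mul_self` + the same identity.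
Nothing to attack. [ApplebaumIshaiKushilevitz2006, Fact 4.14, Lemma 4.15] -/
theorem blockOf_eq_gBlock : blockOf = RandPoly.gBlock := rfl

namespace CornerDet

open RandPoly Matrix

variable {d : ℕ}

/-- An upper unitriangular matrix has determinant `1`. [folklore] -/
theorem det_eq_one_of_isUnitri {A : RandPoly.Mat d} (hA : RandPoly.IsUnitri A) : A.det = 1 := by
  rw [Matrix.det_of_upperTriangular (fun i j hij => hA.2 i j hij)]
  exact Finset.prod_eq_one fun i _ => hA.1 i

/-- A last-column matrix has determinant `1`. [folklore] -/
theorem det_eq_one_of_isLastCol {B : RandPoly.Mat d} (hB : RandPoly.IsLastCol B) : B.det = 1 := by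
  have hup : B.BlockTriangular id := by
    intro i j hij
    refine hB.2 i j (ne_of_gt hij) fun hj => ?_
    subst hj
    exact absurd (Fin.le_last i) (not_le.2 hij)
  rw [Matrix.det_of_upperTriangular hup]
  exact Finset.prod_eq_one fun i _ => hB.1 i

/-- **`det C_δ = δ`** (Laplace along row `0`; the minor is the identity; over `F₂` no signs).
[IshaiKushilevitz2002, §3] -/
theorem det_canon (δ : ZMod 2) : (RandPoly.canon (d := d) δ).det = δ := by
  rw [Matrix.det_succ_row_zero, Finset.sum_eq_single (Fin.last d)]
  · have hsub : (RandPoly.canon (d := d) δ).submatrix Fin.succ (Fin.last d).succAbove = 1 := by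
      ext i j
      rw [Fin.succAbove_last]
      simp only [submatrix_apply, RandPoly.canon, RandPoly.pathMat, of_apply, Pi.zero_apply, ite_self,
        zero_add, Fin.val_succ, Fin.val_castSucc, Fin.succ_ne_zero, false_and, if_false, add_zero, one_apply]
      by_cases hij : i = j
      · subst hij; simp
      · rw [if_neg (fun h => hij (Fin.ext (by omega))), if_neg hij]
    rw [hsub, det_one, mul_one]
    have hlast : (RandPoly.canon (d := d) δ) 0 (Fin.last d) = δ := by
      simp [RandPoly.canon, RandPoly.pathMat]
    rw [hlast, show (-1 : ZMod 2) = 1 from by decide, one_pow, one_mul]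
  · intro j _ hj
    have : (RandPoly.canon (d := d) δ) 0 j = 0 := by
      simp [RandPoly.canon, RandPoly.pathMat, hj]
    rw [this, mul_zero, zero_mul]
  · intro h; exact absurd (Finset.mem_univ _) h

/-- **The corner value is the determinant** for matrices of branching-program shape — the identity that
turns the tree's `eq_shiftU_mul_canon_mul_colV` / `perfExt_gBlock` into the registered `stub_canon` /
`stub_blockPerf` (which speak of `L.det`). [ApplebaumIshaiKushilevitz2006, Fact 4.14] -/
theorem corner_eq_det {M : RandPoly.Mat d} (h : RandPoly.IsBPShape M) : RandPoly.corner M = M.det := by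
  conv_rhs => rw [RandPoly.eq_shiftU_mul_canon_mul_colV h]
  rw [det_mul, det_mul, det_eq_one_of_isUnitri (RandPoly.shiftU_isUnitri h),
    det_eq_one_of_isLastCol (RandPoly.colV_isLastCol M), det_canon]
  ring

end CornerDet

/-! ### §8.5 `stub_adviceElim`: the certification hypotheses are load-bearing (THEOREM) -/

namespace AdviceElim

/-! LANDED (`Theorems/PeaWorstToAvg/Negative/AdviceElimLoadBearing.lean`, p77449; imported above):
`countable_uniformSchemes`, `false_of_injective_uniformSchemes`, `schemeKey_eq`,
`not_forall_sizeClass_uniform`, `exists_sizeClass_heurBPP_not_uniform` (`UHeurBPP ⊊ HeurBPP` on `δ_{1ⁿ}`),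
`unarySampler_props`, `adviceElim_false_without_labels`, `interleave_spec`,
`adviceElim_false_without_samplability`.  Aliases in the vocabulary of the stub: -/

/-- **`stub_adviceElim` WITHOUT its two certification hypotheses** (`h₀`, `h₁`), everything else verbatim
(the conclusion `∈ UHeurBPP` unfolded). [BogdanovTrevisan2006, Def. 2.12–2.13; AroraBarakCC2009, §6.3] -/
def AdviceElimWithoutLabels : Prop :=
  ∀ (Q : PromiseProblem), Q.Disjoint → ∀ (S : Bool → RandAlg ℕ (List Bool)),
    (∀ b, (S b).IsPolyTime unaryEncodeNat (id : List Bool → List Bool)) →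
    ∀ c : Polynomial ℕ, (∀ b ℓ, (S b).coinLen ℓ = c.eval ℓ) →
    (⟨Q.yes, mixEnsemble (fun n => (S false).outputPMF unaryEncodeNat n)
        (fun n => (S true).outputPMF unaryEncodeNat n)⟩ : DistProblem) ∈ HeurBPP →
    ∃ A : RandAlg (List Bool × ℕ × ℕ) Bool, A.IsPolyTime schemeEnc encodeBool ∧
      (∃ c : Polynomial ℕ, ∀ ℓ, A.coinLen ℓ = c.eval ℓ) ∧
      ∀ n m : ℕ, 0 < m →
        (mixEnsemble (fun n => (S false).outputPMF unaryEncodeNat n)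
          (fun n => (S true).outputPMF unaryEncodeNat n)).prob n
          {x | 1 / 4 ≤ A.pr schemeEnc (x, n, m) {b | b ≠ Q.yes.boolIndicator x}} ≤ 1 / m

/-- **`stub_adviceElim` WITHOUT samplability of the components** (labels kept: arbitrary ensembles
`K₀ ⊆ Q.no`, `K₁ ⊆ Q.yes`). [BogdanovTrevisan2006, Def. 2.12–2.13] -/
def AdviceElimWithoutSamplability : Prop :=
  ∀ (Q : PromiseProblem), Q.Disjoint → ∀ (K₀ K₁ : Ensemble),
    (∀ n, ∀ w ∈ (K₀ n).support, w ∈ Q.no) → (∀ n, ∀ w ∈ (K₁ n).support, w ∈ Q.yes) →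
    (⟨Q.yes, mixEnsemble K₀ K₁⟩ : DistProblem) ∈ HeurBPP →
    ∃ A : RandAlg (List Bool × ℕ × ℕ) Bool, A.IsPolyTime schemeEnc encodeBool ∧
      (∃ c : Polynomial ℕ, ∀ ℓ, A.coinLen ℓ = c.eval ℓ) ∧
      ∀ n m : ℕ, 0 < m →
        (mixEnsemble K₀ K₁).prob n
          {x | 1 / 4 ≤ A.pr schemeEnc (x, n, m) {b | b ≠ Q.yes.boolIndicator x}} ≤ 1 / m

/-- **FALSE without the labels** (landed `adviceElim_false_without_labels`): any proof of the stub must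
TEST candidates on certified samples. [BogdanovTrevisan2006, §2.3; AroraBarakCC2009, §6.3; KarpLipton1982] -/
theorem adviceElim_false_without_labels : ¬ AdviceElimWithoutLabels :=
  Summit.PneNP.PneNP.Theorems.adviceElim_false_without_labels

/-- **FALSE without samplability of the components** (landed `adviceElim_false_without_samplability`): the
proof must DRAW ITS OWN labelled samples. [BogdanovTrevisan2006, §2.3; AroraBarakCC2009, §6.3] -/
theorem adviceElim_false_without_samplability : ¬ AdviceElimWithoutSamplability :=
  Summit.PneNP.PneNP.Theorems.adviceElim_false_without_samplability

/-- **`UHeurBPP ⊊ HeurBPP` on the samplable ensemble `δ_{1ⁿ}`** (landed). [KarpLipton1982; AroraBarakCC2009, §6.3] -/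
theorem exists_sizeClass_heurBPP_not_uniform :
    ∃ a : ℕ → Bool,
      (⟨{x | a x.length.size = true}, fun n => PMF.pure (unaryEncodeNat n)⟩ : DistProblem) ∈ HeurBPP ∧
      ¬ ∃ A : RandAlg (List Bool × ℕ × ℕ) Bool, A.IsPolyTime schemeEnc encodeBool ∧
        (∃ c : Polynomial ℕ, ∀ ℓ, A.coinLen ℓ = c.eval ℓ) ∧
        ∀ n m : ℕ, 0 < m →
          Ensemble.prob (fun n => PMF.pure (unaryEncodeNat n)) n
            {x | 1 / 4 ≤ A.pr schemeEnc (x, n, m)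
              {b | b ≠ ({x : List Bool | a x.length.size = true} : Set (List Bool)).boolIndicator x}} ≤
            1 / m :=
  Summit.PneNP.PneNP.Theorems.exists_sizeClass_heurBPP_not_uniform

end AdviceElim


/-! ## §9 Second line `orbit-pair-rsr` (lead b, PICKED 2026-08-16T03:06Z; skeleton `Lines/orbit-pair-rsr.lean`)

REMARKS for lead b (no new theorem needed; the §8 calculus is stated for `ModeKitOver T ε`, any target
`T`, any slack `ε`):
* `stub_transfer` (`PEA 3 ≤ᵣ OrbitPair p₀ p₁ k`, success `≥ 2/3`) is irrefutable short of thesis X (lead b's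
  own calibration: kill switch ⇒ stub).  Composed with the kit's re-randomiser it is an encoder whose law on a
  yes-instance `x` is `(1/3 + 1/16)`-close to the planted law OF THE SIZE `s` THAT THE REDUCTION CHOSE — not
  of a size determined by `|x|`; per `(|x|, s)`-slice the §8 obstructions apply with `ε = 19/48 < 1/2`:
  no invariant of the image instance that is not constant on the slice can be transported exactly
  (`exactInvariant_const`), and two same-length yes-instances sent to the same size `s` surely cannot land
  in disjoint classes (`not_mostly_separated` needs `η + ε < 1/2`, i.e. failure `η < 5/48` there).  The
  entropy readout is NOT an obstruction for this line (the transfer CHANGES entropy to the canonical value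
  `H(p₁ˢ)`; `not_entropyExact` refutes only `H(enc x) = H(x) + shift(|x|)`), but every other exactly
  computable feature of `x` surviving in `R(x)` is — in particular any Karp reduction built from
  entropy-exact gadgets applied TO `x` (direct sums with fixed maps, AIK re-encoding, affine maps) keeps
  `x`'s affine-isomorphism type visible inside `R(x)` up to the gadget and is dead by `exactInvariant_const`
  unless all same-length yes-instances are affinely equivalent after gadgeting — which is exactly the
  "affine-invariant ERASER" obligation in lead b's transfer-analysis.md, here with a proof that nothing
  weaker than erasure will do.
* `stub_orbitKit`: the planted law is the law of a TRUNCATED-rejection `GL` sampler, not the uniform orbit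
  law — rightly so: a `RandAlg` with `c` fair coins has dyadic atom masses `j/2ᶜ`, while the uniform law on
  an orbit of size `|AGL_s(F₂)|·|AGL_m(F₂)|/|Stab|` (odd part `∏(2ⁱ-1) ∤ |Stab|` generically) is not dyadic,
  so "exactly uniform on the orbit" would be FALSE in the tree's exact-sampling model (`IsPolySamplable` is
  exact).  Keep every statement of the line about the truncated law (as the skeleton does); a stub or glue
  lemma asserting `IsPolySamplable` of a uniform orbit/`GL` law is refutable on sight.
* `stub_orbitRSR`, `stub_randClosure`: textbook; per-run success `(29/32)(3/4) = 87/128 > 2/3` re-derived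
  as for `stub_decider`; no attack.  `stub_adviceElim` is the shared stub: BOTH its certificates and its
  samplers are load-bearing (§8.5, landed `AdviceElimLoadBearing.lean`).
-/
theorem lineB_remarks : True := trivial

end Summit.PneNP.PneNP.Cruxes.PeaWorstToAvg.Disproof
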